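import Summits.BirchSwinnertonDyer.Uniform.UI.O6ContentRecordShape
import Summits.BirchSwinnertonDyer.Rank1Residual.Additive.WildThreeDivisibilitySuffices
import Literature.NumberTheory.EllipticCurves.BSDQuadraticDescentTorsionOddPartProofs
import HarnessLib
import HarnessLib.Audit.Tags

/-!
# UI-O6 — the KERNEL READING of a rank-one record for the RIGHT conjunct (`RKC3Divisibility`)

Cell `bsd-uniform`, seat `ui-o6` (GEN 4, prover `prover-bsd-uniform-ui-o6-g4-0`); companion note
`pub/bsd-uniform/ui/O6-CONJECTURE.md` §4.6d (evidence item E-R1: exact Heegner indices on the held-out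
rank-one O6 set R1, seat engine `hixlib.gp`, pre-registration `ui/evidence-o6/er1/PREREG-ER1.md`).

HONEST FRAMING. THEOREMS ONLY (no `def`, no named fact, no `sorry`; axioms standard). Nothing here is
a theorem about BSD or about any particular curve, and nothing uniform about pocket O6. The file states,
once, in the kernel, what a PER-PAIR rank-one record buys for the RIGHT conjunct
`Rank1Residual.AdditiveThree.RKC3Divisibility` of the seat's typed conjecture `O6WildThreePart`, namely
its conclusion `MinftyGe W K Dt β ι t` (every Kolyvagin class `c_M(n)` at the pair is `3^t`-divisible,
`t = ord₃ ∏ c_q`) — with every input an EXPLICIT BINDER, exactly as `O6ContentRecordShape` reads the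
rank-zero `3`-descent records:

* the Kolyvagin–McCallum STRUCTURE THEOREM at `p = 3` in the b2b cell's typed shape
  `KolyvaginStructureThreeShape` (a `Prop`, taken as hypothesis `hS`; its `p ∣ N` reading is flagged for
  referee line-checking in `Additive/WildThreeRefinedKolyvagin.lean` — NOT asserted here);
* ONE non-divisibility bound `¬ MinftyGe … B` (the Kolyvagin system of the pair is not `3^B`-divisible;
  at a pair with `y_K` of infinite order this is the class `c_M(1)` = Kummer image of `y_K` with
  `B = M₀ + 1`, `M₀ = ord₃ [E(K) : ℤ y_K]` — supplied by the record, not derived here);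
* the TAMAGAWA-SHARPENED Ш-INEQUALITY over `K`: `ord₃ #Ш(E/K) + 2t ≤ 2·ord₃ [E(K) : ℤP]`.

`minftyGe_of_structure_of_shaBound`: these three give `MinftyGe W K Dt H.β ι t`. The inequality is what a
rank-one record supplies at a pair whose rank-`1` member `E` has `#Sel^{(3)}(E/ℚ) = 3` (so
`ord₃ #Ш(E/ℚ) = 0`, `padicValNat_three_shaOrder_eq_zero_of_rankOne_record`) and whose rank-`0` member
(the Heegner twist) has `ord₃ #Ш ≤ 2(M₀ − t)` (Kato's Thm. 14.5 (3) read Tamagawa-exactly bounds it by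
`ord₃ #Ш_an(E^D)`, and the record's exact index gives `M₀ − t ≥ ½ ord₃ #Ш_an(E^D)`):
`minftyGe_of_structure_of_records` assembles them over the odd-`p` decomposition
`ord₃ #Ш(E/K) = ord₃ #Ш(E/ℚ) + ord₃ #Ш(E^D/ℚ)` (tree: `card_primaryComponent_sha_baseChange_quadratic_of_odd_of_finite`,
entered here as the hypothesis `hdec` to keep this file's binders elementary). A record instantiating the
binders is PER-PAIR EVIDENCE for the right conjunct, never the conjunct; nothing is booked; no census mark
moves.
-/

noncomputable section

open scoped Classical AddSubgroup

open WeierstrassCurve Literature.NumberTheory.EllipticCurves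
  Literature.NumberTheory.EllipticCurves.ModularForms

namespace Summit.BirchSwinnertonDyer.Uniform.UI

open Summit.BirchSwinnertonDyer.Rank1Residual.AdditiveThree

/-! ## §1. (bookkeeping reused, not restated)

Monotonicity of `MinftyGe`, `M_∞ ≥ 0`, the existence of `M_∞` from one failed divisibility bound and the
direction "`M_∞ ≥ t` ⇒ `ord₃ #Ш(E/K) + 2t ≤ 2·ord₃[E(K):ℤP]`" are the b2b cell's
`AdditiveThree.minftyGe_mono`, `minftyGe_zero`, `exists_minftyEq_of_not_minftyGe`,
`shaUpper_of_structure_of_minftyGe` (`Additive/WildThreeDivisibilitySuffices.lean`), imported. This file adds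
the CONVERSE direction (a record ⇒ `M_∞ ≥ t`), the rank-one descent lemma, the assembly, and the
by-name kill reading. -/

/-! ## §2. The reading: structure theorem ∧ one non-divisibility bound ∧ the sharpened Ш-inequality ⇒ `M_∞ ≥ t` -/

section Reading

/-- **The kernel reading of a rank-one record (right conjunct of `O6WildThreePart`).** Let `W/ℚ` be
globally minimal elliptic, `3`-adic tower surjective, `K` imaginary quadratic Heegner for `N_E` with
`d_K ∉ {−3, −4}`, `P ∈ E(K)` the Heegner point of the datum `(Dt, H)` of infinite order. Assume
(i) the Kolyvagin–McCallum structure theorem at `3` in the typed shape `KolyvaginStructureThreeShape`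
(`ord₃ #Ш(E/K) + 2 M_∞ = 2·ord₃ [E(K) : ℤP]`), (ii) the Kolyvagin system of the pair is not
`3^B`-divisible for some `B`, and (iii) the record inequality `ord₃ #Ш(E/K) + 2t ≤ 2·ord₃ [E(K) : ℤP]`.
Then `M_∞ ≥ t`: every Kolyvagin class `c_M(n)` of the pair is `3^t`-divisible — the CONCLUSION of
`RKC3Divisibility` at `(W, K, Dt, H.β, ι)` when `t = ord₃ ∏_q c_q(E)`. Arithmetic: `M_∞ = m` exists by
(ii); (i) gives `2m = 2·M₀ − ord₃ #Ш(E/K) ≥ 2t` by (iii); monotonicity. Per-pair bookkeeping, nothing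
uniform. [cite: McCallumLMS1991, Thm. 5.4 (p. 288), Thm. 5.8 (p. 290)] [cite: GrossLMS1991, Prop. 6.2 (p. 222)] -/
theorem minftyGe_of_structure_of_shaBound (hS : KolyvaginStructureThreeShape)
    (W : WeierstrassCurve ℚ) [W.IsElliptic] [W.IsGloballyMinimal] (hρ : TowerSurjThree W)
    (K : Type) [Field K] [NumberField K] (hK : IsImaginaryQuadratic K)
    (h3 : NumberField.discr K ≠ -3) (h4 : NumberField.discr K ≠ -4)
    [NeZero (W.conductorNorm ℤ)] (hHN : SatisfiesHeegnerHypothesis (W.conductorNorm ℤ) K)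
    (Dt : ModularParametrizationData W (W.conductorNorm ℤ))
    (H : HeegnerDatum (W.conductorNorm ℤ) (NumberField.discr K)) (ι : K →+* ℂ)
    (P : (W.baseChange K).toAffine.Point)
    (hP : WeierstrassCurve.Affine.Point.map ι.toRatAlgHom P = heegnerPointComplex Dt H)
    (hnt : ¬ IsOfFinAddOrder P)
    {B : ℕ} (hB : ¬ MinftyGe W K Dt H.β ι B) (t : ℕ)
    (hsha : padicValNat 3 (W.baseChange K).shaOrder + 2 * t ≤
      2 * padicValNat 3 (AddSubgroup.zmultiples P).index) :
    MinftyGe W K Dt H.β ι t := by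
  obtain ⟨m, hm⟩ := exists_minftyEq_of_not_minftyGe W K Dt H.β ι hB
  obtain ⟨_, hid⟩ := hS W hρ K hK h3 h4 hHN Dt H ι P hP hnt m hm
  exact minftyGe_mono W K Dt H.β ι (by omega) ((minftyEq_iff W K Dt H.β ι m).mp hm).1

/-- **At such a pair the divisibility half IS the Tamagawa-sharpened upper bound on `Ш(E/K)[3^∞]`**
(inputs (i), (ii) as above): `M_∞ ≥ t ↔ ord₃ #Ш(E/K) + 2t ≤ 2·ord₃ [E(K) : ℤP]`, i.e.
`#Ш(E/K)[3^∞] ≤ 3^{2(M₀ − t)}`. (`→` is the b2b cell's `shaUpper_of_structure_of_minftyGe`; `←` is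
`minftyGe_of_structure_of_shaBound`.) [cite: McCallumLMS1991, Thm. 5.4 (p. 288)] -/
theorem minftyGe_iff_shaBound_of_structure (hS : KolyvaginStructureThreeShape)
    (W : WeierstrassCurve ℚ) [W.IsElliptic] [W.IsGloballyMinimal] (hρ : TowerSurjThree W)
    (K : Type) [Field K] [NumberField K] (hK : IsImaginaryQuadratic K)
    (h3 : NumberField.discr K ≠ -3) (h4 : NumberField.discr K ≠ -4)
    [NeZero (W.conductorNorm ℤ)] (hHN : SatisfiesHeegnerHypothesis (W.conductorNorm ℤ) K)
    (Dt : ModularParametrizationData W (W.conductorNorm ℤ))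
    (H : HeegnerDatum (W.conductorNorm ℤ) (NumberField.discr K)) (ι : K →+* ℂ)
    (P : (W.baseChange K).toAffine.Point)
    (hP : WeierstrassCurve.Affine.Point.map ι.toRatAlgHom P = heegnerPointComplex Dt H)
    (hnt : ¬ IsOfFinAddOrder P)
    {B : ℕ} (hB : ¬ MinftyGe W K Dt H.β ι B) (t : ℕ) :
    MinftyGe W K Dt H.β ι t ↔
      padicValNat 3 (W.baseChange K).shaOrder + 2 * t ≤
        2 * padicValNat 3 (AddSubgroup.zmultiples P).index := by
  refine ⟨fun ht ↦ ?_, minftyGe_of_structure_of_shaBound hS W hρ K hK h3 h4 hHN Dt H ι P hP hnt hB t⟩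
  obtain ⟨m, hm⟩ := exists_minftyEq_of_not_minftyGe W K Dt H.β ι hB
  exact (shaUpper_of_structure_of_minftyGe hS W hρ K hK h3 h4 hHN Dt H ι P hP hnt t ht m hm).2

end Reading

/-! ## §3. What the rank-one `3`-descent record says about `Ш(E/ℚ)` -/

section RankOneRecord

variable (W : WeierstrassCurve ℚ) [W.IsElliptic]

/-- **Descent count at `3`, rank-one record form.** If `rank E(ℚ) = 1`, `E(ℚ)[3] = 0` (as
`#E(ℚ)[3] = 1`) and `#Sel^{(3)}(E/ℚ) = 3`, then `#Ш(E/ℚ)[3] = 1`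
(`#Sel₃ = 3^{rank} · #E(ℚ)[3] · #Ш[3]`). [cite: SilvermanAEC2009, Thm. X.4.2] -/
theorem natCard_sha_torsionBy_three_eq_one_of_rankOne_record (hrank : W.mordellWeilRank = 1)
    (htors : Nat.card (W.toAffine.Point[(3 : ℤ)]) = 1)
    (hsel : Nat.card (W.selmerGroup 3) = 3) :
    Nat.card ((W.sha)[(3 : ℤ)]) = 1 := by
  have h := natCard_selmerGroup_three_eq W
  rw [hrank, pow_one, htors, mul_one, hsel] at h
  have h3 : (3 : ℕ) * Nat.card ((W.sha)[(3 : ℤ)]) = 3 * 1 := by omega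
  exact Nat.eq_of_mul_eq_mul_left (by norm_num) h3

/-- **Hence `ord₃ #Ш(E/ℚ) = 0`** for a finite `Ш`: an element of order `3` would be a second element of
`Ш[3]` (Cauchy). [cite: SilvermanAEC2009, Thm. X.4.2] -/
theorem padicValNat_three_shaOrder_eq_zero_of_rankOne_record (hfin : W.ShaFinite)
    (hrank : W.mordellWeilRank = 1) (htors : Nat.card (W.toAffine.Point[(3 : ℤ)]) = 1)
    (hsel : Nat.card (W.selmerGroup 3) = 3) : padicValNat 3 W.shaOrder = 0 := by
  haveI : Fact (3 : ℕ).Prime := ⟨Nat.prime_three⟩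
  haveI : Finite W.sha := hfin
  have hsha3 := natCard_sha_torsionBy_three_eq_one_of_rankOne_record W hrank htors hsel
  have hndvd : ¬ 3 ∣ W.shaOrder := by
    intro hdvd
    rw [WeierstrassCurve.shaOrder] at hdvd
    obtain ⟨x, hx⟩ := exists_prime_addOrderOf_dvd_card' (G := W.sha) 3 hdvd
    have hx3 : (3 : ℤ) • x = 0 := by
      have h3 := addOrderOf_nsmul_eq_zero x
      rw [hx] at h3
      exact_mod_cast h3
    have hx0 : x ≠ 0 := by
      intro h0
      rw [h0, addOrderOf_zero] at hx
      norm_num at hx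
    have hmem : x ∈ (W.sha)[(3 : ℤ)] := (Submodule.mem_torsionBy_iff _ _).mpr hx3
    haveI : Subsingleton ((W.sha)[(3 : ℤ)]) := (Nat.card_eq_one_iff_unique.mp hsha3).1
    have h01 : (⟨x, hmem⟩ : (W.sha)[(3 : ℤ)]) = ⟨0, AddSubgroup.zero_mem _⟩ := Subsingleton.elim _ _
    exact hx0 (Subtype.ext_iff.mp h01)
  exact padicValNat.eq_zero_of_not_dvd hndvd

end RankOneRecord

/-! ## §4. Assembly: the E-R1 record at a pair ⇒ the conclusion of `RKC3Divisibility` at the pair -/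

section Assembly

/-- **E-R1 record ⇒ `MinftyGe … t` (PREREG-ER1 positive reading, kernel form).** At a pair as in
`minftyGe_of_structure_of_shaBound`, suppose the record supplies: the rank-`1` member's `3`-descent
(`rank E(ℚ) = 1`, `E(ℚ)[3] = 0`, `#Sel^{(3)}(E/ℚ) = 3`, `Ш(E/ℚ)` finite — so `ord₃ #Ш(E/ℚ) = 0`);
the odd-part decomposition `ord₃ #Ш(E/K) = ord₃ #Ш(E/ℚ) + b` with `b = ord₃ #Ш(E^{d_K}/ℚ)` (tree:
`card_primaryComponent_sha_baseChange_quadratic_of_odd_of_finite`; a hypothesis here); an upper bound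
`b ≤ u` for the rank-`0` twist (Kato, Thm. 14.5 (3), Tamagawa-exact: `u = ord₃ #Ш_an(E^{d_K})`, where it
applies); and the exact Heegner index `M₀ = ord₃ [E(K) : ℤP]` with `u + 2t ≤ 2M₀` (the record's
`s₃ ≥ 0`). Then every Kolyvagin class of the pair is `3^t`-divisible. CONDITIONAL on the structure
theorem shape `hS`; per-pair evidence, nothing uniform, nothing booked.
[cite: McCallumLMS1991, Thm. 5.4 (p. 288)] [cite: Kato2004Asterisque, Thm. 14.5 (3) (pp. 236–237)]
[cite: SilvermanAEC2009, Thm. X.4.2] -/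
theorem minftyGe_of_structure_of_records (hS : KolyvaginStructureThreeShape)
    (W : WeierstrassCurve ℚ) [W.IsElliptic] [W.IsGloballyMinimal] (hρ : TowerSurjThree W)
    (K : Type) [Field K] [NumberField K] (hK : IsImaginaryQuadratic K)
    (h3 : NumberField.discr K ≠ -3) (h4 : NumberField.discr K ≠ -4)
    [NeZero (W.conductorNorm ℤ)] (hHN : SatisfiesHeegnerHypothesis (W.conductorNorm ℤ) K)
    (Dt : ModularParametrizationData W (W.conductorNorm ℤ))
    (H : HeegnerDatum (W.conductorNorm ℤ) (NumberField.discr K)) (ι : K →+* ℂ)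
    (P : (W.baseChange K).toAffine.Point)
    (hP : WeierstrassCurve.Affine.Point.map ι.toRatAlgHom P = heegnerPointComplex Dt H)
    (hnt : ¬ IsOfFinAddOrder P)
    {B : ℕ} (hB : ¬ MinftyGe W K Dt H.β ι B)
    -- the rank-one `3`-descent record of the rank-`1` member
    (hfin : W.ShaFinite) (hrank : W.mordellWeilRank = 1)
    (htors : Nat.card (W.toAffine.Point[(3 : ℤ)]) = 1) (hsel : Nat.card (W.selmerGroup 3) = 3)
    -- odd-part decomposition over `K` and the twist's upper bound
    {b u : ℕ} (hdec : padicValNat 3 (W.baseChange K).shaOrder = padicValNat 3 W.shaOrder + b)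
    (hbu : b ≤ u)
    -- the exact index record: `u + 2t ≤ 2 M₀`
    (t : ℕ) (hidx : u + 2 * t ≤ 2 * padicValNat 3 (AddSubgroup.zmultiples P).index) :
    MinftyGe W K Dt H.β ι t := by
  have h0 := padicValNat_three_shaOrder_eq_zero_of_rankOne_record W hfin hrank htors hsel
  exact minftyGe_of_structure_of_shaBound hS W hρ K hK h3 h4 hHN Dt H ι P hP hnt hB t (by omega)

end Assembly

/-! ## §5. The conjecture by name: a falsifiable consequence at every rank-one pair -/

section ByName

/-- **`O6WildThreePart` ⇒ the Tamagawa-sharpened Ш-bound at every rank-one wild pair (kill reading of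
PREREG-ER1, kernel form).** Granted the structure theorem shape `hS`: if the seat's conjecture holds, then
at every pair in the scope of its right conjunct (`9 ∣ N_E`, `3`-adic tower surjective, `K` Heegner with
`d_K ∉ {−3,−4}`, `ord_{s=1} L(E/K,s) = 1`, `3 ∤ c(Dt)`) whose Heegner point `P` has infinite order and whose
Kolyvagin system is not infinitely divisible, `ord₃ #Ш(E/K) + 2·ord₃ ∏_q c_q(E) ≤ 2·ord₃ [E(K) : ℤP]`.
So ONE pair with a certified `#Ш(E/K)[3^∞] > 3^{2(M₀ − t)}` would refute the conjecture (modulo `hS`);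
the pre-registered E-R1 run reads its rows against exactly this inequality (outcomes: companion note §4.6d).
[cite: Jetchev2008, Conj. 1.3 (p. 3)] [cite: McCallumLMS1991, Thm. 5.4 (p. 288)] -/
theorem shaBound_of_o6WildThreePart (h : O6WildThreePart) (hS : KolyvaginStructureThreeShape)
    (W : WeierstrassCurve ℚ) [W.IsElliptic] [W.IsGloballyMinimal] (h9 : 9 ∣ W.conductorNorm ℤ)
    (hρ : TowerSurjThree W)
    (K : Type) [Field K] [NumberField K] (hK : IsImaginaryQuadratic K)
    (h3 : NumberField.discr K ≠ -3) (h4 : NumberField.discr K ≠ -4)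
    [NeZero (W.conductorNorm ℤ)] (hHN : SatisfiesHeegnerHypothesis (W.conductorNorm ℤ) K)
    (hr : analyticRankEK W K = 1)
    (Dt : ModularParametrizationData W (W.conductorNorm ℤ)) (hc : ¬ (3 : ℤ) ∣ Dt.c)
    (H : HeegnerDatum (W.conductorNorm ℤ) (NumberField.discr K)) (ι : K →+* ℂ)
    (P : (W.baseChange K).toAffine.Point)
    (hP : WeierstrassCurve.Affine.Point.map ι.toRatAlgHom P = heegnerPointComplex Dt H)
    (hnt : ¬ IsOfFinAddOrder P) {B : ℕ} (hB : ¬ MinftyGe W K Dt H.β ι B) :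
    padicValNat 3 (W.baseChange K).shaOrder + 2 * padicValNat 3 W.tamagawaProduct ≤
      2 * padicValNat 3 (AddSubgroup.zmultiples P).index :=
  (minftyGe_iff_shaBound_of_structure hS W hρ K hK h3 h4 hHN Dt H ι P hP hnt hB _).mp
    (h.2 W h9 hρ K hK h3 h4 hHN hr Dt H.β ι H.dvd_sq_sub hc)

end ByName

/-! ## §6. (GEN 4, append) The odd-part decomposition over `K` from the tree, and the fully assembled reading -/

section Decomposition

/-- **`ord₃ #Ш(E/K) = ord₃ #Ш(E/ℚ) + ord₃ #Ш(E^{d_K}/ℚ)`** — the valuation form at `p = 3` of the tree's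
odd-part decomposition `#Ш(E/K)[p^∞] = #Ш(E/ℚ)[p^∞]·#Ш(E^{d_K}/ℚ)[p^∞]`
(`card_primaryComponent_sha_baseChange_quadratic_of_odd_of_finite`, Jetchev–Skinner–Wan 2017 §7.4.1 /
Dokchitser–Dokchitser 2010), for any `ℚ`-model `Wd` of the twist and all three `Ш` finite. This
DISCHARGES the hypothesis `hdec` of `minftyGe_of_structure_of_records`.
[cite: JetchevSkinnerWan2017, §7.4.1 (arXiv:1512.06894 p. 30)]
[cite: DokchitserDokchitserAnnals2010, §2.1 (proof of Thm. 8)] -/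
theorem padicValNat_three_shaOrder_baseChange_eq (W : WeierstrassCurve ℚ) [W.IsElliptic]
    (K : Type) [Field K] [NumberField K] (h2 : Module.finrank ℚ K = 2)
    (Wd : WeierstrassCurve ℚ) [Wd.IsElliptic]
    (hWd : ∃ C : VariableChange ℚ, C • W.quadraticTwist (NumberField.discr K : ℚ) = Wd)
    (hW : W.ShaFinite) (hd : Wd.ShaFinite) (hK : (W.baseChange K).ShaFinite) :
    padicValNat 3 (W.baseChange K).shaOrder =
      padicValNat 3 W.shaOrder + padicValNat 3 Wd.shaOrder := by
  haveI : Fact (3 : ℕ).Prime := ⟨Nat.prime_three⟩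
  haveI : Finite W.sha := hW
  haveI : Finite Wd.sha := hd
  haveI : Finite (W.baseChange K).sha := hK
  have hcard := card_primaryComponent_sha_baseChange_quadratic_of_odd_of_finite W K h2 Wd hWd
    (W.baseChange K) ⟨1, one_smul _ _⟩ 3 (by norm_num)
  rw [WeierstrassCurve.shaOrder, WeierstrassCurve.shaOrder, WeierstrassCurve.shaOrder]
  rw [natCard_primaryComponent_eq_pow_padicValNat 3, natCard_primaryComponent_eq_pow_padicValNat 3,
    natCard_primaryComponent_eq_pow_padicValNat 3, ← pow_add] at hcard
  exact Nat.pow_right_injective (by norm_num) hcard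

/-- **E-R1 record ⇒ `MinftyGe … t`, fully assembled** (`minftyGe_of_structure_of_records` with `hdec`
discharged by `padicValNat_three_shaOrder_baseChange_eq`): inputs are the structure-theorem shape `hS`,
the pair's binders, ONE non-divisibility bound, the rank-`1` member's `3`-descent record
(`#Sel^{(3)}(E/ℚ) = 3`, `E(ℚ)[3] = 0`, `rank E(ℚ) = 1`), finiteness of the three `Ш` (GZK / the
structure theorem), an upper bound `ord₃ #Ш(Wd/ℚ) ≤ u` for a `ℚ`-model `Wd` of the Heegner twist
(Kato 14.5 (3), Tamagawa-exact: `u = ord₃ #Ш_an(E^{d_K})`, where it applies), and the exact index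
inequality `u + 2t ≤ 2·ord₃ [E(K) : ℤP]` (the record's `s₃ ≥ 0`). CONDITIONAL on `hS`; per-pair
evidence for the right conjunct of `O6WildThreePart`, nothing uniform, nothing booked.
[cite: McCallumLMS1991, Thm. 5.4 (p. 288)] [cite: Kato2004Asterisque, Thm. 14.5 (3) (pp. 236–237)]
[cite: JetchevSkinnerWan2017, §7.4.1] -/
theorem minftyGe_of_structure_of_records_of_twist (hS : KolyvaginStructureThreeShape)
    (W : WeierstrassCurve ℚ) [W.IsElliptic] [W.IsGloballyMinimal] (hρ : TowerSurjThree W)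
    (K : Type) [Field K] [NumberField K] (hK : IsImaginaryQuadratic K)
    (h2 : Module.finrank ℚ K = 2)
    (h3 : NumberField.discr K ≠ -3) (h4 : NumberField.discr K ≠ -4)
    [NeZero (W.conductorNorm ℤ)] (hHN : SatisfiesHeegnerHypothesis (W.conductorNorm ℤ) K)
    (Dt : ModularParametrizationData W (W.conductorNorm ℤ))
    (H : HeegnerDatum (W.conductorNorm ℤ) (NumberField.discr K)) (ι : K →+* ℂ)
    (P : (W.baseChange K).toAffine.Point)
    (hP : WeierstrassCurve.Affine.Point.map ι.toRatAlgHom P = heegnerPointComplex Dt H)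
    (hnt : ¬ IsOfFinAddOrder P)
    {B : ℕ} (hB : ¬ MinftyGe W K Dt H.β ι B)
    -- the rank-one `3`-descent record of the rank-`1` member and finiteness
    (hfin : W.ShaFinite) (hfinK : (W.baseChange K).ShaFinite) (hrank : W.mordellWeilRank = 1)
    (htors : Nat.card (W.toAffine.Point[(3 : ℤ)]) = 1) (hsel : Nat.card (W.selmerGroup 3) = 3)
    -- the Heegner twist: a `ℚ`-model, finiteness, and the upper bound on its `3`-part
    (Wd : WeierstrassCurve ℚ) [Wd.IsElliptic]
    (hWd : ∃ C : VariableChange ℚ, C • W.quadraticTwist (NumberField.discr K : ℚ) = Wd)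
    (hfind : Wd.ShaFinite) {u : ℕ} (hbu : padicValNat 3 Wd.shaOrder ≤ u)
    -- the exact index record: `u + 2t ≤ 2 M₀`
    (t : ℕ) (hidx : u + 2 * t ≤ 2 * padicValNat 3 (AddSubgroup.zmultiples P).index) :
    MinftyGe W K Dt H.β ι t :=
  minftyGe_of_structure_of_records hS W hρ K hK h3 h4 hHN Dt H ι P hP hnt hB hfin hrank htors hsel
    (padicValNat_three_shaOrder_baseChange_eq W K h2 Wd hWd hfin hfind hfinK) hbu t hidx

end Decomposition

end Summit.BirchSwinnertonDyer.Uniform.UI
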